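import Summits.CriticalPhenomena.PercolationContinuityZ3.Theorems.PercNearOneGluingNoHeavyPcintKernZ6S4Defs
import HarnessLib

/-!
# PCINT lane, kernel check 4/4 of the B2r window certificate `d = 6`, memory 4 (3-step windows, 1728 codes): codes `1296 ≤ c < 1728`

Cell `prim-pcint`, seat `prim-pcint-2` (gen 2).  Collatz–Wielandt rows `10^5 · row ≤ 99999 · DEN · v` for the window codes in
`[1296, 1728)`, by `decide +kernel` in chunks of `108` codes (natural-number arithmetic only; `maxHeartbeats 0`).
Does NOT build on p205010.
-/

namespace Summit.CriticalPhenomena.PercolationContinuityZ3.Theorems.Pcint.Z6S4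

set_option maxHeartbeats 0 in
/-- Rows `1296 ≤ c < 1404` of the certificate hold. [folklore] -/
theorem chk_1296_1404 : chk 1296 1404 = true := by decide +kernel

set_option maxHeartbeats 0 in
/-- Rows `1404 ≤ c < 1512` of the certificate hold. [folklore] -/
theorem chk_1404_1512 : chk 1404 1512 = true := by decide +kernel

set_option maxHeartbeats 0 in
/-- Rows `1512 ≤ c < 1620` of the certificate hold. [folklore] -/
theorem chk_1512_1620 : chk 1512 1620 = true := by decide +kernel

set_option maxHeartbeats 0 in
/-- Rows `1620 ≤ c < 1728` of the certificate hold. [folklore] -/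
theorem chk_1620_1728 : chk 1620 1728 = true := by decide +kernel

/-- Rows `1296 ≤ c < 1728` of the certificate hold. [folklore] -/
theorem chkFile_4 : chk 1296 1728 = true :=
  chk_split (chk_split (chk_split chk_1296_1404 chk_1404_1512) chk_1512_1620) chk_1620_1728

end Summit.CriticalPhenomena.PercolationContinuityZ3.Theorems.Pcint.Z6S4
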